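import Mathlib
import HarnessLib
import HarnessLib.Audit
import Summits.NavierStokesRegularity.Statement
import Literature.Analysis.FluidPDE.ClassicalSolution
import Literature.Analysis.FluidPDE.LerayHopf
import Literature.Analysis.FluidPDE.VectorCalculus
import Literature.Analysis.FluidPDE.NSWave0
import Literature.Analysis.FluidPDE.NormalisedPressure
import Summits.NavierStokesRegularity.NavierStokesRegularity.Theorems.TypeICertificateLadderNoBlowupToClay
import HarnessLib.Audit.Status.Attr

/-!
Route: BernoulliDeceleration

DORMANT since 2026-08-29T19:39:42Z (census g0: costume|duplicate of —; reader census-reader-49-g0) — unstaffed, not closed; items shared with open routes are served there. `ledger route dormant <id> --off` reactivates.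

# Route BernoulliDeceleration — Clay (A) via the Bernoulli head — every head maximum decelerates, so
Seregin–Šverák's one-sided criterion needs the head only on the strongly decelerating set

Card realised: NavierStokesRegularity/NavierStokesRegularity/bernoulli-head-decelerating-set (spine,
sole card).
Notation: Π̃(t,x) := ‖u(t,x)‖²/2 + p̃[u(t)](x), the Bernoulli head built with the in-tree NORMALISED
(Riesz) pressure
`Literature.Analysis.FluidPDE.normalisedPressure (u t) x` (a function of the velocity slice alone;
Tao's normalisation
`tao_pressure_normalisation_holds` is PROVED in-tree); D := {(t,x) : ∂ₜ‖u‖²(t,x) ≤ −2ν‖curl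
u(t,x)‖²}, the strongly
decelerating set (∂ₜ = `timeDerivWithin (Ico 0 T)`).
X (DeceleratingSetHeadBound): it suffices to show that for every ν>0, T>0 and every classical
solution (u,p) of unforced NS
on ℝ³×[0,T) which is Leray–Hopf from a rapidly decaying datum u(0), the head is bounded above ON THE
DECELERATING SET:
∃ K, ∀ t∈[0,T), ∀ x, (t,x) ∈ D → Π̃(t,x) ≤ K. Nothing is asked of Π̃ where the fluid speeds up.
Lean: `∀ (ν T : ℝ), 0 < ν → 0 < T → ∀ (u : ℝ → EuclideanSpace ℝ (Fin 3) → EuclideanSpace ℝ (Fin 3))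
(p : ℝ → EuclideanSpace ℝ (Fin 3) → ℝ), Literature.Analysis.FluidPDE.IsClassicalNSSolutionOn
(Set.Ico 0 T) ν 0 u p → Literature.Analysis.FluidPDE.IsLerayHopfOn T ν 0 (u 0) u →
Literature.Analysis.FluidPDE.HasRapidSpatialDecay (u 0) → ∃ K : ℝ, ∀ t ∈ Set.Ico 0 T, ∀ x,
Literature.Analysis.FluidPDE.timeDerivWithin (Set.Ico 0 T) (fun s z => ‖u s z‖ ^ 2) t x ≤ -(2 * ν *
‖Literature.Analysis.FluidPDE.curl (u t) x‖ ^ 2) → ‖u t x‖ ^ 2 / 2 +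
Literature.Analysis.FluidPDE.normalisedPressure (u t) x ≤ K`

## Assembly
PURE LOGIC, verified sorry-free in the planner's Sketch.lean (lean check rc 0, remote): given
NoBlowup's data (ν,T,u,p), X hands K with Π̃ ≤ K on D; for any (t,x) either Π̃(t,x) ≤ 0 or
HeadPeaksDecelerate gives y ∈ D(t) with Π̃(t,x) ≤ Π̃(t,y) ≤ K; so Π̃ ≤ max K 0 on [0,T)×ℝ³ and
OneSidedHeadRegularity yields HasSmoothExtensionPast; NoBlowupToClay (= stmt-0055) converts NoBlowup
into Clay (A). ~12 lines. Cruxes 3–4 are NOT in the chain (they are the pointwise refinement and the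
structural corollary).

UNDER FLOOR: fewer than 2 cruxes remain after retriage (legacy route; D-0019).

Rationale: WHY THIS LINE. One exact pointwise identity for classical solutions, read ELLIPTICALLY at fixed
time: with 𝓛 := νΔ − u·∇ and Π := |u|²/2+p,
𝓛Π = ν|ω|² + ∂ₜ(|u|²/2) (from Δp = ½|ω|²−|S|², |∇u|² = |S|²+½|ω|², u·∇Π = νu·Δu − ∂ₜ|u|²/2;
re-derived by hand and by the
novelty auditor). At a spatial local maximum of Π(t,·), ∇Π=0 and ΔΠ≤0 give ∂ₜ|u|² ≤ −2ν|ω|²: EVERY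
head maximum lies in D(t)
(support HeadMaxPointLemma, pure calculus, gauge-invariant). Since Π̃(t,·)→0 at infinity and — a
sanity check recorded below —
lim_R ∫_{B_R} p̃ = −‖u(t)‖²₂/3 forces sup Π̃(t,·) > 0 for every non-zero slice, the supremum of the
head over ℝ³ is ATTAINED,
and attained inside D(t) (support HeadPeaksDecelerate). Hence a bound on Π̃ over D is a bound over
ℝ³×[0,T), and the
one-sided theorem of SereginSverak2002 (ARMA 163: a weak solution of the Cauchy problem with
|u|²/2+p bounded above, or p
bounded below, is regular; crux OneSidedHeadRegularity, cite-gated) plus the PROVED continuation of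
bounded classical
Leray–Hopf solutions (`hasSmoothExtensionPast_of_bounded_holds`, RobinsonRodrigoSadowski2016 Thm
8.17) give NoBlowup, and the
shared local-theory assembly stmt-NavierStokesRegularity-0055 gives Clay (A). Imported areas:
elliptic maximum principles for
drift-Laplacians (GilbargTrudinger2001 Thm 3.1) transplanted from the STEADY head-pressure
technology (NecasRuzickaSverak1996,
Tsai1998, KorobkovPileckasRusso2012, Amick 1988) to time slices of unsteady flows, and
ε-regularity/blow-up rescaling only
through SS2002. What no prior route does: TypeILiouville/GaldiLiouvilleGate/VorticityGeometry
control blow-up by rate,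
enstrophy records or vorticity direction; MonotoneCritical by a critical norm; here the controlled
quantity is ONE-SIDED (an
upper bound on a sign-indefinite scalar) and is demanded only on a dynamically defined set. Compared
with the card: the card's
rank-2 crux (a LOCAL SS2002) is NOT load-bearing here — the attained-maximum argument makes the
ORIGINAL global SS2002 suffice —
and is filed separately (LocalOneSidedHeadRegularity) because it unlocks the pointwise criterion and
the local 'no monotone
blow-up' theorem (NoLocallyMonotoneBlowup); the card's GLOBAL 'no monotone blow-up' is dropped as
vacuous (see Cheapest falsifier).

RANKED CRUXES. #0 DeceleratingSetHeadBound (target) — X above: for finite-energy classical solutions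
from rapidly decaying data, sup of Π̃ over the strongly decelerating set D ∩ ([0,T)×ℝ³) is finite.
Equivalent (given cruxes 2 and the supports) to NoBlowup; the bet is that on D the local energy
balance ∂ₜ(|u|²/2) + u·∇Π − νΔ(|u|²/2) = −ν|∇u|² has its first term ≤ −ν|ω|², a favourable sign for
De Giorgi/Moser-type upper bounds of the 𝓛-subsolution-like quantity Π. (why it might fail: It is a
supercritical a-priori bound (Π̃ scales like |u|²):
Literature.Barriers.NavierStokesRegularity.EnergySupercriticality is not evaded on D; a Type-II
(Tao-cascade-like) singularity could carry diverging head maxima inside ever smaller decelerating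
sheaths.) [SereginSverak2002, Tao2016AveragedNS, arXiv:1402.0290, Hou2022PotentiallySingularNS]
#2 OneSidedHeadRegularity (crux) — Seregin–Šverák 2002 transcribed to the Clay setting (card
engine): ν>0, T>0, (u,p) classical on ℝ³×[0,T), Leray–Hopf from a rapidly decaying u(0); if Π̃ =
|u|²/2 + p̃[u] ≤ K on [0,T)×ℝ³ (normalised pressure), then u extends as a classical solution past T.
Proof plan: SS2002 main theorem (regularity on ℝ³×(0,T] under |u|²/2+p ≤ g, p the normalised
pressure; our class — smooth, suitable, Schwartz datum, g ≡ K — sits inside theirs) ⇒ u bounded on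
(δ,T)×ℝ³ ⇒ restart at an energy-good time and `hasSmoothExtensionPast_of_bounded_holds` +
`HasSmoothExtensionPast.of_translate` (the in-tree pattern of NSCriticalClosureBounded.lean).
Expected to become `(h : seregin_sverak_2002) → …` once the cite item lands; it is rank 2 because
the route's import cone is gated on it. [difficulty: M] (why it might fail: Transcription risk only:
SS2002 is paywalled/cite-only here (acq-01580); if its printed class needs g with spatial decay,
data in a class our u(0) misses, or the bound in a form other than p̃-normalised, the hypotheses
must be adjusted (set-signature).) [SereginSverak2002, doi:10.1007/s002050200199,
RobinsonRodrigoSadowski2016, Tao2011]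
#3 LocalOneSidedHeadRegularity (crux) — LOCAL Seregin–Šverák at a point (card crux 1): same global
hypotheses; if Π̃ ≤ K on the backward cylinder (T−r²,T)×B_r(x₀), then u is bounded on
(T−(r/2)²,T)×B_{r/2}(x₀). Mechanism: SS2002's blow-up argument only sees a neighbourhood of the
singular point; for a CAUCHY solution the far-field (harmonic) part of p̃ near x₀ is bounded by
C·E₀/r³ and vanishes under rescaling (also under the sup-normalised Type-II rescaling, Π̃_k ≤ K/M_k²
→ 0), so the limit still has Π̄ ≤ 0 and the Liouville step ∫P̄ = −∫|Ū|²/3 ⇒ Ū ≡ 0 applies. Not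
load-bearing for the Assembly; it makes criterion X pointwise and is the engine of
NoLocallyMonotoneBlowup. [deps: OneSidedHeadRegularity] [difficulty: L] (why it might fail: If
SS2002's Liouville step needs DECAY of the blow-up limit's pressure (global formula ∫P = −∫|U|²/3 on
ℝ³) rather than one-sided boundedness, the local version needs the KNSS bounded-ancient pressure
decomposition and control of its harmonic part in time (Serrin-type gauge freedom).)
[SereginSverak2002, KochNadirashviliSereginSverak2009, arXiv:0709.3599, Serrin1962,
CaffarelliKohnNirenberg1982]
#4 NoLocallyMonotoneBlowup (crux) — No locally monotone blow-up (card Theorem-candidate A, LOCAL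
form): same global hypotheses; if on a backward cylinder (T−r²,T)×B_r(x₀) the speed is weakly
accelerating, ∂ₜ|u|² ≥ −2ν|ω|² (in particular if |u(x,t)|² is non-decreasing in t there), and the
head Π̃ is bounded above on the lateral boundary (T−r²,T)×∂B_r(x₀) (automatic when that sphere
consists of regular points: local smoothness + far-field kernel bound C·E₀/dist³), then u is bounded
on (T−(r/2)²,T)×B_{r/2}(x₀): a singularity cannot simply intensify, it must be wrapped at all times
in points slowing faster than enstrophy dissipation. Proof plan: slice-wise weak maximum principle
for 𝓛Π ≥ 0 on B_r (GilbargTrudinger2001 Thm 3.1; Π and Π̃ differ by c(t)) ⇒ Π̃ ≤ K on the cylinder ⇒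
crux 3. The GLOBAL form (weak acceleration on all of ℝ³) is deliberately NOT filed: it is vacuous
(Π̃(t,·) ≤ 0 on ℝ³ forces u(t) ≡ 0). [deps: LocalOneSidedHeadRegularity] [difficulty: L] (why it
might fail: Inherits crux 3 (local SS2002); independently refutable by a blow-up candidate whose
core is pointwise accelerating with bounded lateral head — e.g. if Hou's axisymmetric scenario
(arXiv:2107.06509) shows no decelerating sheath inside the collapsing region.) [SereginSverak2002,
GilbargTrudinger2001, Hou2022PotentiallySingularNS, arXiv:2107.06509, NecasRuzickaSverak1996]
#9 HeadMaxPointLemma (support) — The fixed-time max-point lemma (card item 2, PROVABLE NOW, pure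
calculus, any gauge): for ν ≥ 0 and a classical solution (u,p) of unforced NS on [0,T)×ℝ³, at every
t ∈ [0,T) and every spatial local maximum x of y ↦ |u(t,y)|²/2 + p(t,y) one has ∂ₜ|u|²(t,x) ≤
−2ν|curl u(t,x)|² (∂ₜ one-sided within [0,T) at t = 0). Proof: the identity 𝓛Π = ν|ω|² + ∂ₜ(|u|²/2)
(chain rule, Δp = −tr((∇u)²) = ½|ω|² − |S|² from div of the momentum equation — in-tree
`laplacian_pressure_eq_of_isClassicalNSSolutionOn` at interior times, t = 0 by continuity — and
`norm_curl_sq_eq_frobeniusNormSq_spin`), then ∇Π = 0, ΔΠ ≤ 0 at a local max. [difficulty: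
provable-now] [NecasRuzickaSverak1996, Tsai1998, MajdaBertozzi2002]
#9 HeadPeaksDecelerate (support) — Positive head values are dominated by the head at a strongly
decelerating point: under the global hypotheses, for t ∈ [0,T) and x with Π̃(t,x) > 0 there is y
with ∂ₜ|u|²(t,y) ≤ −2ν|curl u(t,y)|² and Π̃(t,x) ≤ Π̃(t,y). Proof plan: (i) u(t,·) → 0 and p̃[u(t)]
→ 0 at spatial infinity for every t < T (H^k persistence for classical Leray–Hopf solutions from
Schwartz data, or far-field ε-regularity: in-tree LerayFarFieldEpsilonRegularity;
NormalisedPressureFarField), so the continuous Π̃(t,·) attains its positive supremum at some y; (ii)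
p(t,·) − p̃[u(t)] is constant in x for EVERY t (harmonic —
`harmonicOnNhd_pressure_sub_pressurePotential` — and tempered; Tao 2011 Lemma 4.1(i) =
`tao_pressure_normalisation_holds` gives a.e. t, continuity the rest), so y is a local max of |u|²/2
+ p(t,·) and HeadMaxPointLemma applies. Load-bearing in the Assembly. [difficulty: M] [Tao2011,
CaffarelliKohnNirenberg1982, SereginSverak2002]
#9 NoBlowupToClay (support) — = stmt-NavierStokesRegularity-0055 (shared with TypeILiouville,
GaldiLiouvilleGate, VorticityGeometry; re-asked verbatim so the gate attaches this route): NoBlowup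
(every finite-energy classical solution from a rapidly decaying datum extends past every T) → Clay
(A), by local classical existence, continuation, weak–strong uniqueness, energy inequality and
`isNavierStokesSolution_and_smooth_iff`. [difficulty: M] [Leray1934, Fefferman2000,
RobinsonRodrigoSadowski2016]

TWO-LAYER PLAN. Foreseen glued splits (nothing filed now). X ⇐ X_loc → Compactness → X, with X_loc
the POINTWISE criterion 'z₀=(T,x₀) regular ⇐ Π̃ bounded above on D ∩ Q_r(z₀) and on the lateral
boundary' (needs crux 3) and Compactness = the singular set at the first singular time is compact
(far-field ε-regularity) so finitely many cylinders cover it. OneSidedHeadRegularity ⇐ (h :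
seregin_sverak_2002 Literature fact) → BoundedOnStrip → OneSidedHeadRegularity once the cite item
lands. NoLocallyMonotoneBlowup ⇐ SliceWeakMaxPrinciple → LocalOneSidedHeadRegularity →
NoLocallyMonotoneBlowup. HeadPeaksDecelerate ⇐ SliceDecayAtInfinity → EveryTimePressureGauge →
HeadMaxPointLemma-application.

KILL CRITERIA. OneSidedHeadRegularity refuted AS STATED (a counterexample inside our class) would
mean SS2002 is mis-transcribed: pivot by set-signature to the printed hypotheses, not a close.
LocalOneSidedHeadRegularity refuted (a Cauchy solution, Π̃ locally bounded above near a singular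
point): close cruxes 3–4 as refuted, the global line X survives untouched. DeceleratingSetHeadBound
refuted = a finite-time singularity of a finite-energy classical solution from Schwartz data =
¬Clay(A): close `refuted:DeceleratingSetHeadBound` and hand the witness (with its decelerating
sheath of diverging head maxima — a NECESSARY feature by HeadPeaksDecelerate + SS2002) to routes
Blowup/CertifiedBlowup. NoBlowup (stmt-0054) proved elsewhere moots the route; SS2002 landing as a
Literature fact demotes crux 2 to support.

NOT DECOMPOSED YET. How X would be proved (De Giorgi/Moser iteration for Π on D using the favourable
sign of ∂ₜ|u|² there; ε-regularity in terms of the one-sided scale-invariant quantity r⁻¹ sup_t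
∫_{B_r∩D(t)} Π̃₊; Type-I vs Type-II split) — deliberately untouched until cruxes 2–3 settle what
'bounded above' must mean locally. The quantitative 'deceleration budget' version of the card (item
3: ∂ₜ|u|² ≥ −λ(t) − 2ν|ω|² with a Dini condition on λ) is NOT filed: the comparison barrier for 𝓛
lives only on balls of radius ≲ ν/‖u(t)‖_∞, the singular scale, and chaining to infinity loses
everything; it returns only if crux 3 supplies a local anchor. The dual statement (head MINIMA lie
in {∂ₜ|u|² ≥ −2ν|ω|²}, SS2002's p ≥ −g branch) does not assemble and is not filed. Lateral-boundary
bookkeeping ('sphere of regular points ⇒ Π̃ bounded there') rides as a `--supports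
NoLocallyMonotoneBlowup` lemma, never an item.

CHEAPEST FALSIFIER. (a) Direction of SS2002 (is the criterion |u|²/2+p bounded ABOVE / p bounded
BELOW?): if misremembered the whole line collapses to the non-assembling dual; the title 'lower
bounds on the pressure' and p = Π − |u|²/2 ≥ −g ⇐ … are consistent with the card, the
zbMATH/crossref records confirm title/venue only (paywalled, acq-01580) — the grounder of crux 2
settles it on the printed page. (b) Vacuity checks, run by hand at planning time: the GLOBAL 'no
monotone blow-up' (weak acceleration on all of ℝ³) is VACUOUS — weak maximum principle ⇒ Π̃(t,·) ≤ 0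
on ℝ³, and lim_R ∫_{B_R} p̃ = −‖u(t)‖²/3 < −‖u(t)‖²/2 is impossible unless u(t) ≡ 0 — so it was
dropped and only the local form (crux 4) is filed; the same computation shows D(t) ≠ ∅ for every
non-zero slice, so X is never vacuous. (c) Kit/DNS probe for crux 4 and for the bet behind X: in
Hou's axisymmetric scenario (arXiv:2107.06509) or a Burgers-vortex/ring-collision DNS, track the
head maximum and the set D(t) in the final phase: is the maximum's neighbourhood decelerating
(predicted: always) and does sup_D Π̃ grow like ‖u‖²_∞ (would show X has no slack over plain
SS2002)?

NUMBERS. Known one-sided criteria: 2 (SS2002: Π bounded above; p bounded below), both global on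
ℝ³×(0,T). Steady head maximum principles: NRŠ 1996 / Tsai 1998 (self-similar profiles, 𝓛Π ≤ 0 with
the y·∇ drift), Gilbarg–Weinberger 1978, Amick 1988, KPR (KorobkovPileckasRusso2012,
arXiv:1009.4024) — all time-independent. lim_R ∫_{B_R} p̃[v] = −‖v‖²₂/3 (spherical average of the
symbol ξᵢξⱼ/|ξ|²). Items at open: 8 (3 cruxes, 1 target, 3 support, 1 assembly).

DEFINITION REQUESTS. None: `normalisedPressure`, `curl`, `timeDerivWithin`,
`IsClassicalNSSolutionOn`, `IsLerayHopfOn`, `HasRapidSpatialDecay`, `HasSmoothExtensionPast`,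
Mathlib `IsLocalMax`/`Metric.ball`/`Metric.sphere` all exist (lean search --decl). Cite fact wanted
(filed after open as a cite item): `seregin_sverak_2002` — SereginSverak2002 main theorem (one-sided
pressure/head criterion for suitable weak solutions of the Cauchy problem), topic
Literature/Analysis/FluidPDE; crux 2 becomes `(h : fact) → …` when it lands.

Novelty: Searches (2026-08-15, this planner, on top of the card's audited searches of the same day): `lit
frontier NavierStokesRegularity --since 2021` (30 rows; pressure-side only arXiv:2606.08352
'one-component regularity via harmonic pressure' — ε-regularity, read pp.1–2, different mechanism),
`lit bridges NavierStokesRegularity --cross any` (surveys/convex integration, nothing on head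
criteria), zbMATH 'one-sided pressure condition regularity Navier-Stokes' (2 hits, steady Boussinesq
BVPs), zbMATH 'Bernoulli pressure |u|^2/2+p regularity nonstationary' (15, none relevant), zbMATH
'total head pressure maximum principle Navier-Stokes' (3: KorobkovPileckasRusso2012 arXiv:1009.4024,
Weng–Chae arXiv:1512.03491, arXiv:2510.10488 — all STEADY), crossref (SS2002
doi:10.1007/s002050200199 record; Chae2023 doi:10.1007/s00033-023-01984-0 'oscillation of pressure'
— paywalled acq-01653, content unverified, flagged by the card's auditor as the one place a
fixed-time sup/inf argument could already sit), `lit galaxy search --star all/pdf/crabby` for 'lower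
bound(s) on the pressure', 'pressure is bounded below', 'head pressure', 'oscillation of the
pressure' (+2 intelligent-mode runs): 0 relevant hits; held books read: Fefferman–Robinson–Rodrigo
2018 LMS vol. ch.9 (Tran–Yu, pp.209–212: L^q-evolution with a 'pressure moderator', integral
criteria, no maximum principle), Lemarié-Rieusset 2016 p.354 (pressure criteria = integrability of
∇ϖ: BerselliGaldi2002, Zhou, Struwe), Seregin 2014 (SS2002 not  [refs: 10.1007/s002050200199, 10.1007/s00033-023-01984-0, 10.1088/0951-7715/29/10/2990, 2606.08352, 1009.4024, 1512.03491, 2510.10488, doi:10.1007/s002050200199, doi:10.1007/s00033-023-01984-0, doi:10.1088/0951-7715/29/10/2990, KorobkovPileckasRusso2012, Chae2023, BerselliGaldi2002, SereginSverak2002, NecasRuzickaSverak1996, Tsai1998, TranYu2016]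

Barriers (technique_class: one-sided-pressure, fixed-time-max-principle): - technique_class: one-sided-pressure, fixed-time-max-principle
- Literature.Barriers.NavierStokesRegularity.EnergySupercriticality: NOT evaded by the target X (Π̃
scales like |u|², a bound on it is a critical/supercritical a-priori estimate won from energy-class
data); the bet is structural — on D the local energy balance has the sign ∂ₜ|u|²/2 ≤ −ν|ω|² — not an
energy cascade count. Cruxes 2–4 and the supports are scale-invariant one-sided statements that
never use the energy coercively (energy enters only as the far-field kernel bound E₀/r³).
- Literature.Barriers.NavierStokesRegularity.TaoAveragedBlowup: the identity uses the EXACT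
pointwise algebra Δp = ½|ω|² − |S|² and u·((u·∇)u) = u·∇(|u|²/2); an averaged bilinear form B̃ has
no pointwise Bernoulli law and no head, so HeadMaxPointLemma/HeadPeaksDecelerate are false for
averaged NS and the line is outside the barrier's class; but X itself, being an a-priori bound, is
where a Tao-type Type-II cascade would have to be excluded — conceded, same bet as above.
- Literature.Barriers.NavierStokesRegularity.TruncatedDyadicBlowup: same as TaoAveragedBlowup —
dyadic/shell models carry no pressure and no pointwise head; the mechanism does not transfer to
them, so their blow-ups say nothing about cruxes 2–4, and nothing for X either way.
- Literature.Barriers.NavierStokesRegularity.NavierStokesInequalitySingularSolution: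
Scheffer/Ożański singular solutions of the NS INEQUALITY violate the local energy EQUALITY from
which 𝓛Π = ν|ω|²

History (route lifecycle, newest last):
- 2026-08-16T04:11:43Z · AUTO-CRUX (backfill): DeceleratingSetHeadBound — hypotheses of the deciding theorem that nothing in the route derives are cruxes (operator:999:1085951)
- 2026-08-22T17:53:18Z · DORMANT — reconciler: no traction for 5.5 d (last activity item-evidence-added at 2026-08-17T04:21:55Z); parked, not closed — `ledger route dormant route-NavierStokesRegu (operator:999:2602342)
- 2026-08-27T05:09:22Z · REACTIVATED — reconciler: reactivated — activity item-proof-filed at 2026-08-27T03:52:20Z after parking at 2026-08-22T17:53:18Z (operator:999:1016593)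
- 2026-08-29T19:39:42Z · DORMANT — census g0: costume|duplicate of —; reader census-reader-49-g0 (operator:999:1559458)

sub-problem: NavierStokesRegularity · status: dormant · opened planner-plancard-NavierStokesRegularity-Navie-9c874cc3-0 2026-08-15T11:10:24Z · rev 2 · ledger route-NavierStokesRegularity-BernoulliDeceleration
GENERATED by the gate from the ledger (D-0016/17). Provers cite these decls: `theorem foo : Summit.NavierStokesRegularity.NavierStokesRegularity.Theses.BernoulliDeceleration.<Decl> := …` in Summits/NavierStokesRegularity/NavierStokesRegularity/Theorems/<Name>.lean.
-/

namespace Summit.NavierStokesRegularity.NavierStokesRegularity.Theses.BernoulliDeceleration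

open scoped BigOperators Topology Manifold Classical MeasureTheory ProbabilityTheory Matrix InnerProductSpace ComplexConjugate ContinuousMap
open Filter Set Function TopologicalSpace MeasureTheory

attribute [summit_statement] _root_.NavierStokesRegularity

open Literature.NS

/-- item stmt-NavierStokesRegularity-3032 · crux (kind.auto-crux: conjecture-grade) · rank 0 · open · by planner
why it might fail: Equivalent to NoBlowup on this class (seregin_sverak_2002 landed + HeadPeaksDecelerate): a supercritical a-priori bound (Π̃ ~ |u|²), no shield against EnergySupercriticality on D; fails iff Clay (A) fails, e.g. a Type-II cascade with diverging head maxima inside shrinking decelerating sheaths.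
sources: SereginSverak2002, Tao2016AveragedNS, Hou2022PotentiallySingularNS, Literature.Barriers.NavierStokesRegularity.EnergySupercriticality
[target] X above: for finite-energy classical solutions from rapidly decaying data, sup of Π̃ over
the strongly decelerating set D ∩ ([0,T)×ℝ³) is finite. Equivalent (given cruxes 2 and the supports)
to NoBlowup; the bet is that on D the local energy balance ∂ₜ(|u|²/2) + u·∇Π − νΔ(|u|²/2) = −ν|∇u|²
has its first term ≤ −ν|ω|², a favourable sign for De Giorgi/Moser-type upper bounds of the
𝓛-subsolution-like quantity Π. -/
@[route_item "route-NavierStokesRegularity-BernoulliDeceleration", crux]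
def DeceleratingSetHeadBound : Prop :=
  ∀ (ν T : ℝ), 0 < ν → 0 < T → ∀ (u : ℝ → EuclideanSpace ℝ (Fin 3) → EuclideanSpace ℝ (Fin 3)) (p : ℝ → EuclideanSpace ℝ (Fin 3) → ℝ), Literature.Analysis.FluidPDE.IsClassicalNSSolutionOn (Set.Ico 0 T) ν 0 u p → Literature.Analysis.FluidPDE.IsLerayHopfOn T ν 0 (u 0) u → Literature.Analysis.FluidPDE.HasRapidSpatialDecay (u 0) → ∃ K : ℝ, ∀ t ∈ Set.Ico 0 T, ∀ x, Literature.Analysis.FluidPDE.timeDerivWithin (Set.Ico 0 T) (fun s z => ‖u s z‖ ^ 2) t x ≤ -(2 * ν * ‖Literature.Analysis.FluidPDE.curl (u t) x‖ ^ 2) → ‖u t x‖ ^ 2 / 2 + Literature.Analysis.FluidPDE.normalisedPressure (u t) x ≤ K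

/-- item stmt-NavierStokesRegularity-3034 · crux · rank 3 · open · by planner
why it might fail: False iff a first blow-up time carries BOTH a singular point with locally bounded head AND a distant unbounded-head one (were all bounded-head, compactness + global SS2002 give regularity): exotic, unexcluded; localising SS2002's proof yields only Type-I-like bounds on A(z,ρ), open off-axis.
sources: SereginSverak2002, GuevaraPhuc2017, GustafsonKangTsai2007, KochNadirashviliSereginSverak2009, SereginSverak2009, CaffarelliKohnNirenberg1982
[crux] LOCAL Seregin–Šverák at a point (card crux 1): same global hypotheses; if Π̃ ≤ K on the
backward cylinder (T−r²,T)×B_r(x₀), then u is bounded on (T−(r/2)²,T)×B_{r/2}(x₀). Mechanism: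
SS2002's blow-up argument only sees a neighbourhood of the singular point; for a CAUCHY solution the
far-field (harmonic) part of p̃ near x₀ is bounded by C·E₀/r³ and vanishes under rescaling (also
under the sup-normalised Type-II rescaling, Π̃_k ≤ K/M_k² → 0), so the limit still has Π̄ ≤ 0 and
the Liouville step ∫P̄ = −∫|Ū|²/3 ⇒ Ū ≡ 0 applies. Not load-bearing for the Assembly; it makes
criterion X pointwise and is the engine of NoLocallyMonotoneBlowup. [deps: OneSidedHeadRegularity]
[difficulty: L] -/
@[route_item "route-NavierStokesRegularity-BernoulliDeceleration"]
def LocalOneSidedHeadRegularity : Prop :=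
  ∀ (ν T : ℝ), 0 < ν → 0 < T → ∀ (u : ℝ → EuclideanSpace ℝ (Fin 3) → EuclideanSpace ℝ (Fin 3)) (p : ℝ → EuclideanSpace ℝ (Fin 3) → ℝ), Literature.Analysis.FluidPDE.IsClassicalNSSolutionOn (Set.Ico 0 T) ν 0 u p → Literature.Analysis.FluidPDE.IsLerayHopfOn T ν 0 (u 0) u → Literature.Analysis.FluidPDE.HasRapidSpatialDecay (u 0) → ∀ (x₀ : EuclideanSpace ℝ (Fin 3)) (r K : ℝ), 0 < r → r ^ 2 < T → (∀ t ∈ Set.Ioo (T - r ^ 2) T, ∀ x ∈ Metric.ball x₀ r, ‖u t x‖ ^ 2 / 2 + Literature.Analysis.FluidPDE.normalisedPressure (u t) x ≤ K) → ∃ M : ℝ, ∀ t ∈ Set.Ioo (T - (r / 2) ^ 2) T, ∀ x ∈ Metric.ball x₀ (r / 2), ‖u t x‖ ≤ M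

/-- item stmt-NavierStokesRegularity-3033 · support · rank 2 · open · by planner
why it might fail: Transcription risk only: SS2002 is paywalled/cite-only here (acq-01580); if its printed class needs g with spatial decay, data in a class our u(0) misses, or the bound in a form other than p̃-normalised, the hypotheses must be adjusted (set-signature).
sources: SereginSverak2002, TranYu2017, Farwig2020, Literature.Analysis.FluidPDE.seregin_sverak_2002.of_head_le, RobinsonRodrigoSadowski2016
[crux] Seregin–Šverák 2002 transcribed to the Clay setting (card engine): ν>0, T>0, (u,p) classical
on ℝ³×[0,T), Leray–Hopf from a rapidly decaying u(0); if Π̃ = |u|²/2 + p̃[u] ≤ K on [0,T)×ℝ³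
(normalised pressure), then u extends as a classical solution past T. Proof plan: SS2002 main
theorem (regularity on ℝ³×(0,T] under |u|²/2+p ≤ g, p the normalised pressure; our class — smooth,
suitable, Schwartz datum, g ≡ K — sits inside theirs) ⇒ u bounded on (δ,T)×ℝ³ ⇒ restart at an
energy-good time and `hasSmoothExtensionPast_of_bounded_holds` +
`HasSmoothExtensionPast.of_translate` (the in-tree pattern of NSCriticalClosureBounded.lean).
Expected to become `(h : seregin_sverak_2002) → …` once the cite item lands; it is rank 2 because
the route's import cone is gated on it. [difficulty: M] -/
@[route_item "route-NavierStokesRegularity-BernoulliDeceleration", crux]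
def OneSidedHeadRegularity : Prop :=
  ∀ (ν T : ℝ), 0 < ν → 0 < T → ∀ (u : ℝ → EuclideanSpace ℝ (Fin 3) → EuclideanSpace ℝ (Fin 3)) (p : ℝ → EuclideanSpace ℝ (Fin 3) → ℝ), Literature.Analysis.FluidPDE.IsClassicalNSSolutionOn (Set.Ico 0 T) ν 0 u p → Literature.Analysis.FluidPDE.IsLerayHopfOn T ν 0 (u 0) u → Literature.Analysis.FluidPDE.HasRapidSpatialDecay (u 0) → (∃ K : ℝ, ∀ t ∈ Set.Ico 0 T, ∀ x, ‖u t x‖ ^ 2 / 2 + Literature.Analysis.FluidPDE.normalisedPressure (u t) x ≤ K) → Literature.Analysis.FluidPDE.HasSmoothExtensionPast ν 0 u T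

/-- item stmt-NavierStokesRegularity-3035 · support · rank 4 · open · by planner
why it might fail: Inherits crux 3 (local SS2002); independently refutable by a blow-up candidate whose core is pointwise accelerating with bounded lateral head — e.g. if Hou's axisymmetric scenario (arXiv:2107.06509) shows no decelerating sheath inside the collapsing region.
sources: GilbargTrudinger2001, Tao2011, SereginSverak2002, Hou2022PotentiallySingularNS, NecasRuzickaSverak1996
[crux] No locally monotone blow-up (card Theorem-candidate A, LOCAL form): same global hypotheses;
if on a backward cylinder (T−r²,T)×B_r(x₀) the speed is weakly accelerating, ∂ₜ|u|² ≥ −2ν|ω|² (in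
particular if |u(x,t)|² is non-decreasing in t there), and the head Π̃ is bounded above on the
lateral boundary (T−r²,T)×∂B_r(x₀) (automatic when that sphere consists of regular points: local
smoothness + far-field kernel bound C·E₀/dist³), then u is bounded on (T−(r/2)²,T)×B_{r/2}(x₀): a
singularity cannot simply intensify, it must be wrapped at all times in points slowing faster than
enstrophy dissipation. Proof plan: slice-wise weak maximum principle for 𝓛Π ≥ 0 on B_r
(GilbargTrudinger2001 Thm 3.1; Π and Π̃ differ by c(t)) ⇒ Π̃ ≤ K on the cylinder ⇒ crux 3. The
GLOBAL form (weak acceleration on all of ℝ³) is deliberately NOT filed: it is vacuous (Π̃(t,·) ≤ 0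
on ℝ³ forces u(t) ≡ 0). [deps: LocalOneSidedHeadRegularity] [difficulty: L] -/
@[route_item "route-NavierStokesRegularity-BernoulliDeceleration"]
def NoLocallyMonotoneBlowup : Prop :=
  ∀ (ν T : ℝ), 0 < ν → 0 < T → ∀ (u : ℝ → EuclideanSpace ℝ (Fin 3) → EuclideanSpace ℝ (Fin 3)) (p : ℝ → EuclideanSpace ℝ (Fin 3) → ℝ), Literature.Analysis.FluidPDE.IsClassicalNSSolutionOn (Set.Ico 0 T) ν 0 u p → Literature.Analysis.FluidPDE.IsLerayHopfOn T ν 0 (u 0) u → Literature.Analysis.FluidPDE.HasRapidSpatialDecay (u 0) → ∀ (x₀ : EuclideanSpace ℝ (Fin 3)) (r : ℝ), 0 < r → r ^ 2 < T → (∀ t ∈ Set.Ioo (T - r ^ 2) T, ∀ x ∈ Metric.ball x₀ r, -(2 * ν * ‖Literature.Analysis.FluidPDE.curl (u t) x‖ ^ 2) ≤ Literature.Analysis.FluidPDE.timeDerivWithin (Set.Ico 0 T) (fun s z => ‖u s z‖ ^ 2) t x) → (∃ K : ℝ, ∀ t ∈ Set.Ioo (T - r ^ 2) T, ∀ x ∈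 Metric.sphere x₀ r, ‖u t x‖ ^ 2 / 2 + Literature.Analysis.FluidPDE.normalisedPressure (u t) x ≤ K) → ∃ M : ℝ, ∀ t ∈ Set.Ioo (T - (r / 2) ^ 2) T, ∀ x ∈ Metric.ball x₀ (r / 2), ‖u t x‖ ≤ M

/-- item stmt-NavierStokesRegularity-0055 · support · rank 9 · closed · proved by Summit.NavierStokesRegularity.NavierStokesRegularity.Theorems.typeICertificateLadder_noBlowupToClay_proof @ 8d57e70af7e2 (prover) · by planner
sources: Leray1934, Fefferman2000, RobinsonRodrigoSadowski2016
Given NoBlowup, build the Clay (A) solution: local finite-energy classical solution for smooth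
divergence-free rapidly decaying data (Leray 1934 §III / Fujita–Kato 1964 + LPS smoothing), continue
past every T using NoBlowup, glue by weak–strong uniqueness (Prodi–Serrin), bounded energy from the
energy inequality, and convert with
Literature.Analysis.FluidPDE.isNavierStokesSolution_and_smooth_iff. Blow-up at spatial infinity is
excluded by CKN ε-regularity applied far out. May take named Literature facts (leray_existence_R3,
ladyzhenskaya_prodi_serrin, weak_strong_uniqueness, fujita_kato_local) as hypotheses if the grounder
so rules. -/
@[route_item "route-NavierStokesRegularity-BernoulliDeceleration", crux]
def NoBlowupToClay : Prop :=
  (∀ (ν T : ℝ), 0 < ν → 0 < T → ∀ (u : ℝ → EuclideanSpace ℝ (Fin 3) → EuclideanSpace ℝ (Fin 3)) (p : ℝ → EuclideanSpace ℝ (Fin 3) → ℝ), Literature.Analysis.FluidPDE.IsClassicalNSSolutionOn (Set.Ico 0 T) ν 0 u p → Literature.Analysis.FluidPDE.IsLerayHopfOn T ν 0 (u 0) u → Literature.Analysis.FluidPDE.HasRapidSpatialDecay (u 0) → Literature.Analysis.FluidPDE.HasSmoothExtensionPast ν 0 u T) → NavierStokesRegularity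

/-- `NoBlowupToClay` holds: proved by `Summit.NavierStokesRegularity.NavierStokesRegularity.Theorems.typeICertificateLadder_noBlowupToClay_proof` @ 8d57e70af7e2. -/
theorem NoBlowupToClay_holds : NoBlowupToClay := _root_.Summit.NavierStokesRegularity.NavierStokesRegularity.Theorems.typeICertificateLadder_noBlowupToClay_proof

/-- item stmt-NavierStokesRegularity-3036 · support · rank 9 · closed · proved by Summit.NavierStokesRegularity.NavierStokesRegularity.Theorems.bernoulliDeceleration_headMaxPointLemma_proof (prover) · by planner
sources: NecasRuzickaSverak1996, Tsai1998, MajdaBertozzi2002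
[support] The fixed-time max-point lemma (card item 2, PROVABLE NOW, pure calculus, any gauge): for
ν ≥ 0 and a classical solution (u,p) of unforced NS on [0,T)×ℝ³, at every t ∈ [0,T) and every
spatial local maximum x of y ↦ |u(t,y)|²/2 + p(t,y) one has ∂ₜ|u|²(t,x) ≤ −2ν|curl u(t,x)|² (∂ₜ
one-sided within [0,T) at t = 0). Proof: the identity 𝓛Π = ν|ω|² + ∂ₜ(|u|²/2) (chain rule, Δp =
−tr((∇u)²) = ½|ω|² − |S|² from div of the momentum equation — in-tree
`laplacian_pressure_eq_of_isClassicalNSSolutionOn` at interior times, t = 0 by continuity — and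
`norm_curl_sq_eq_frobeniusNormSq_spin`), then ∇Π = 0, ΔΠ ≤ 0 at a local max. [difficulty:
provable-now] -/
@[route_item "route-NavierStokesRegularity-BernoulliDeceleration"]
def HeadMaxPointLemma : Prop :=
  ∀ (ν T : ℝ), 0 ≤ ν → ∀ (u : ℝ → EuclideanSpace ℝ (Fin 3) → EuclideanSpace ℝ (Fin 3)) (p : ℝ → EuclideanSpace ℝ (Fin 3) → ℝ), Literature.Analysis.FluidPDE.IsClassicalNSSolutionOn (Set.Ico 0 T) ν 0 u p → ∀ t ∈ Set.Ico 0 T, ∀ x, IsLocalMax (fun y => ‖u t y‖ ^ 2 / 2 + p t y) x → Literature.Analysis.FluidPDE.timeDerivWithin (Set.Ico 0 T) (fun s y => ‖u s y‖ ^ 2) t x ≤ -(2 * ν * ‖Literature.Analysis.FluidPDE.curl (u t) x‖ ^ 2)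

-- `HeadMaxPointLemma` holds: proved by `Summit.NavierStokesRegularity.NavierStokesRegularity.Theorems.bernoulliDeceleration_headMaxPointLemma_proof` (its module imports this route file, so no `_holds` link can be stated here).

/-- item stmt-NavierStokesRegularity-3037 · support · rank 9 · closed · proved by Summit.NavierStokesRegularity.NavierStokesRegularity.Theorems.bernoulliDeceleration_headPeaksDecelerate_proof (prover) · by planner
sources: Tao2011, CaffarelliKohnNirenberg1982, SereginSverak2002
[support] Positive head values are dominated by the head at a strongly decelerating point: under the
global hypotheses, for t ∈ [0,T) and x with Π̃(t,x) > 0 there is y with ∂ₜ|u|²(t,y) ≤ −2ν|curl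
u(t,y)|² and Π̃(t,x) ≤ Π̃(t,y). Proof plan: (i) u(t,·) → 0 and p̃[u(t)] → 0 at spatial infinity for
every t < T (H^k persistence for classical Leray–Hopf solutions from Schwartz data, or far-field
ε-regularity: in-tree LerayFarFieldEpsilonRegularity; NormalisedPressureFarField), so the continuous
Π̃(t,·) attains its positive supremum at some y; (ii) p(t,·) − p̃[u(t)] is constant in x for EVERY t
(harmonic — `harmonicOnNhd_pressure_sub_pressurePotential` — and tempered; Tao 2011 Lemma 4.1(i) =
`tao_pressure_normalisation_holds` gives a.e. t, continuity the rest), so y is a local max of |u|²/2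
+ p(t,·) and HeadMaxPointLemma applies. Load-bearing in the Assembly. [difficulty: M] -/
@[route_item "route-NavierStokesRegularity-BernoulliDeceleration", crux]
def HeadPeaksDecelerate : Prop :=
  ∀ (ν T : ℝ), 0 < ν → 0 < T → ∀ (u : ℝ → EuclideanSpace ℝ (Fin 3) → EuclideanSpace ℝ (Fin 3)) (p : ℝ → EuclideanSpace ℝ (Fin 3) → ℝ), Literature.Analysis.FluidPDE.IsClassicalNSSolutionOn (Set.Ico 0 T) ν 0 u p → Literature.Analysis.FluidPDE.IsLerayHopfOn T ν 0 (u 0) u → Literature.Analysis.FluidPDE.HasRapidSpatialDecay (u 0) → ∀ t ∈ Set.Ico 0 T, ∀ x, 0 < ‖u t x‖ ^ 2 / 2 + Literature.Analysis.FluidPDE.normalisedPressure (u t) x → ∃ y, Literature.Analysis.FluidPDE.timeDerivWithin (Set.Ico 0 T) (fun s z => ‖u s z‖ ^ 2) t y ≤ -(2 * ν * ‖Literature.Analysis.FluidPDE.curl (u t) y‖ ^ 2) ∧ ‖u t x‖ ^ 2 / 2 + Literature.Analysis.FluidPDE.normalisedPressure (u t) x ≤ ‖u t y‖ ^ 2 /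 2 + Literature.Analysis.FluidPDE.normalisedPressure (u t) y

-- `HeadPeaksDecelerate` holds: proved by `Summit.NavierStokesRegularity.NavierStokesRegularity.Theorems.bernoulliDeceleration_headPeaksDecelerate_proof` (its module imports this route file, so no `_holds` link can be stated here).

/-- item stmt-NavierStokesRegularity-3038 · assembly · rank 1 · closed · proved by Summit.NavierStokesRegularity.NavierStokesRegularity.Theorems.bernoulliDeceleration_assembly_proof (prover) · by planner
sources: SereginSverak2002, Fefferman2000
[assembly] OneSidedHeadRegularity → HeadPeaksDecelerate → DeceleratingSetHeadBound → NoBlowupToClay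
→ NavierStokesRegularity (signatures expanded so that the shared items dedup by normalised
signature). -/
@[route_item "route-NavierStokesRegularity-BernoulliDeceleration"]
def Assembly : Prop :=
  (∀ (ν T : ℝ), 0 < ν → 0 < T → ∀ (u : ℝ → EuclideanSpace ℝ (Fin 3) → EuclideanSpace ℝ (Fin 3)) (p : ℝ → EuclideanSpace ℝ (Fin 3) → ℝ), Literature.Analysis.FluidPDE.IsClassicalNSSolutionOn (Set.Ico 0 T) ν 0 u p → Literature.Analysis.FluidPDE.IsLerayHopfOn T ν 0 (u 0) u → Literature.Analysis.FluidPDE.HasRapidSpatialDecay (u 0) → (∃ K : ℝ, ∀ t ∈ Set.Ico 0 T, ∀ x, ‖u t x‖ ^ 2 / 2 + Literature.Analysis.FluidPDE.normalisedPressure (u t) x ≤ K) → Literature.Analysis.FluidPDE.HasSmoothExtensionPast ν 0 u T) → (∀ (ν T : ℝ), 0 < ν → 0 < T → ∀ (u : ℝ → EuclideanSpace ℝ (Fin 3) → EuclideanSpace ℝ (Fin 3)) (p : ℝ → EuclideanSpace ℝ (Fin 3) → ℝ), Literature.Analysis.FluidPDE.IsClassicalNSSolutionOn (Set.Ico 0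 T) ν 0 u p → Literature.Analysis.FluidPDE.IsLerayHopfOn T ν 0 (u 0) u → Literature.Analysis.FluidPDE.HasRapidSpatialDecay (u 0) → ∀ t ∈ Set.Ico 0 T, ∀ x, 0 < ‖u t x‖ ^ 2 / 2 + Literature.Analysis.FluidPDE.normalisedPressure (u t) x → ∃ y, Literature.Analysis.FluidPDE.timeDerivWithin (Set.Ico 0 T) (fun s z => ‖u s z‖ ^ 2) t y ≤ -(2 * ν * ‖Literature.Analysis.FluidPDE.curl (u t) y‖ ^ 2) ∧ ‖u t x‖ ^ 2 / 2 + Literature.Analysis.FluidPDE.normalisedPressure (u t) x ≤ ‖u t y‖ ^ 2 / 2 + Literature.Analysis.FluidPDE.normalisedPressure (u t) y) → (∀ (ν T : ℝ), 0 < ν → 0 < T → ∀ (u : ℝ → EuclideanSpace ℝ (Fin 3) → EuclideanSpace ℝ (Fin 3)) (p : ℝ → EuclideanSpace ℝ (Fin 3) → ℝ), Literature.Analysis.FluidPDE.IsClassicalNSSolutionOn (Set.Ico 0 T) ν 0 u p → Literature.Analysis.FluidPDE.IsLerayHopfOn T ν 0 (u 0) u → Literature.Analysis.FluidPDE.HasRapidSpatialDecay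 (u 0) → ∃ K : ℝ, ∀ t ∈ Set.Ico 0 T, ∀ x, Literature.Analysis.FluidPDE.timeDerivWithin (Set.Ico 0 T) (fun s z => ‖u s z‖ ^ 2) t x ≤ -(2 * ν * ‖Literature.Analysis.FluidPDE.curl (u t) x‖ ^ 2) → ‖u t x‖ ^ 2 / 2 + Literature.Analysis.FluidPDE.normalisedPressure (u t) x ≤ K) → ((∀ (ν T : ℝ), 0 < ν → 0 < T → ∀ (u : ℝ → EuclideanSpace ℝ (Fin 3) → EuclideanSpace ℝ (Fin 3)) (p : ℝ → EuclideanSpace ℝ (Fin 3) → ℝ), Literature.Analysis.FluidPDE.IsClassicalNSSolutionOn (Set.Ico 0 T) ν 0 u p → Literature.Analysis.FluidPDE.IsLerayHopfOn T ν 0 (u 0) u → Literature.Analysis.FluidPDE.HasRapidSpatialDecay (u 0) → Literature.Analysis.FluidPDE.HasSmoothExtensionPast ν 0 u T) → NavierStokesRegularity) → NavierStokesRegularity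

-- `Assembly` holds: proved by `Summit.NavierStokesRegularity.NavierStokesRegularity.Theorems.bernoulliDeceleration_assembly_proof` (its module imports this route file, so no `_holds` link can be stated here).

/-! D-0027 §2.1 — DECIDING THEOREM (planner-authored via `route open/edit --closes-file`; by planner-rbadge-NavierStokesRegularity-Bernoull-9bf3e6e7-g2-0 2026-08-15T16:17:21Z):
its hypotheses are this route's items and its conclusion the sub-problem Statement (glue_lint), and it elaborates with this file. -/

@[closes "route-NavierStokesRegularity-BernoulliDeceleration"] theorem closes (hX : DeceleratingSetHeadBound) (hSS : OneSidedHeadRegularity)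
    (hClay : NoBlowupToClay) (hPeak : HeadPeaksDecelerate) : _root_.NavierStokesRegularity := by
  -- NoBlowupToClay reduces Clay (A) to NoBlowup: every finite-energy classical solution from a
  -- rapidly decaying datum extends smoothly past every T.
  refine hClay ?_
  intro ν T hν hT u p hcl hLH hdec
  -- X: the head Π̃ = ‖u‖²/2 + p̃[u] is bounded above by K on the strongly decelerating set D.
  obtain ⟨K, hK⟩ := hX ν T hν hT u p hcl hLH hdec
  -- Seregin–Šverák (OneSidedHeadRegularity): it suffices that Π̃ ≤ max K 0 on all of [0,T)×ℝ³.
  refine hSS ν T hν hT u p hcl hLH hdec ⟨max K 0, ?_⟩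
  intro t ht x
  by_cases hpos : 0 < ‖u t x‖ ^ 2 / 2 + Literature.Analysis.FluidPDE.normalisedPressure (u t) x
  · -- a positive head value is dominated by the head at a decelerating point y ∈ D(t), where Π̃ ≤ K
    obtain ⟨y, hyD, hxy⟩ := hPeak ν T hν hT u p hcl hLH hdec t ht x hpos
    exact le_trans hxy (le_trans (hK t ht y hyD) (le_max_left _ _))
  · exact le_trans (not_lt.mp hpos) (le_max_right _ _)

end Summit.NavierStokesRegularity.NavierStokesRegularity.Theses.BernoulliDeceleration
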